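import Summits.ResolutionOfSingularities.ResolutionOfSingularities.Theorems.FrobeniusLadderFInjectiveMacaulayficationCIThetaTransport
import Summits.ResolutionOfSingularities.ResolutionOfSingularities.Theorems.FrobeniusLadderFInjectiveMacaulayficationCIPolyKit
import Mathlib.RingTheory.MvPolynomial.WeightedHomogeneous
import HarnessLib

/-!
# Cell-to-chart transport in the term-list currency (crux `FInjectiveMacaulayfication`, K-T4 / file 12c)

[OURS · L1 W4.5a] Support file for crux stmt-ResolutionOfSingularities-15315 (seat table v5, stub-6; planner rulings R11.4 / R11.12 /
R12.9 (h)).  The transport theorem `CIThetaTransport.hcert_of_cellCertificate` needs, per chart `V` and stratum `S`, the chart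
identity `Y^{d_l} · g_l(Y_S = 0) = θ P_l` and the identification of `P_l` with the initial forms `in_w F_l` certified by a CELL
theorem (`T11PlusCells*`, `T4PlusCells*`).  Here both are discharged from DECIDABLE list data in the currency of `CIPolyKit`
(term lists `(c, v) : ℤ × (Fin n → ℕ)`): `weightedHomogeneousComponent_evalL` (weighted components of a term list are the filtered
sub-lists), and **`hcert_entry_of_lists`**: from (a) the `θ`-factorisation witness `List.Forall₂ (t.1 = t'.1 ∧ V·t.2 = d_l + t'.2) F_l g_l`
(`CIPolyKit.theta_evalL`), (b) a coefficient-congruence check that the cell's initial forms `G_l` equal the face-initial sub-list of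
`F_l` for the face weight `w_S = Σ_{i∈S} V i` and degree `D_l = Σ_{i∈S} d_l i` (`CIPolyKit.evalL_eq_of_coeff_congr`), and (c) the cell
certificate for `G` (a landed `cell<id>` theorem, or `CIPolyKitCells.hcert_two_torus_of_lists … (by decide)`), it returns the entry
`∃ tt js e', (∀ i ∈ S, e' i = 0) ∧ Y^{e'} ∈ (g_l(Y_S = 0)) + (2 × 2 minors)` of the `hcert` hypothesis of
`CIConeFiModelSmooth.ciConeFiModelRel_of_smoothFaceCertificates` / `T11PlusFiModel.t11PlusFiModelRel_of_charts` for the strict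
transforms `gs c l :=` the value of `g_l`; the matching `hθF` entry is `CIPolyKit.theta_evalL` itself.  So a chart list is
instantiated by ONE application per (chart, stratum) plus `decide`, re-using the finitely many cell theorems.
No definition is declared; AI-written, weaker than expert review; no statement of [claim: Hironaka2017] is used. [folklore]
-/

-- single-problem summit: the doubled namespace component is forced
set_option linter.dupNamespace false

noncomputable section

namespace Summit.ResolutionOfSingularities.ResolutionOfSingularities.Theorems.FInjectiveMacaulayfication.CIThetaTransport

open MvPolynomial

variable {K : Type} [Field K] {n : ℕ}

/-- **Weighted components of a term list** are its filtered sub-lists. [folklore] -/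
theorem weightedHomogeneousComponent_evalL (w : Fin n → ℕ) (D : ℕ) (L : List (ℤ × (Fin n → ℕ))) :
    weightedHomogeneousComponent w D
        ((L.map fun t : ℤ × (Fin n → ℕ) =>
          (monomial (Finsupp.equivFunOnFinite.symm t.2) ((t.1 : ℤ) : K) : MvPolynomial (Fin n) K)).sum) =
      ((L.filter fun t : ℤ × (Fin n → ℕ) => ∑ j : Fin n, t.2 j * w j = D).map fun t : ℤ × (Fin n → ℕ) =>
          (monomial (Finsupp.equivFunOnFinite.symm t.2) ((t.1 : ℤ) : K) : MvPolynomial (Fin n) K)).sum := by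
  classical
  induction L with
  | nil => simp
  | cons t L ih =>
    rw [List.map_cons, List.sum_cons, map_add, ih, List.filter_cons]
    have hmon : weightedHomogeneousComponent w D
        (monomial (Finsupp.equivFunOnFinite.symm t.2) ((t.1 : ℤ) : K) : MvPolynomial (Fin n) K) =
        if ∑ j : Fin n, t.2 j * w j = D then monomial (Finsupp.equivFunOnFinite.symm t.2) ((t.1 : ℤ) : K) else 0 := by
      rw [weightedHomogeneousComponent_of_mem (isWeightedHomogeneous_monomial w _ _ rfl), Q6CNKit.weight_symm]
      by_cases h : ∑ j : Fin n, t.2 j * w j = D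
      · rw [if_pos h, if_pos h.symm]
      · rw [if_neg h, if_neg (fun h' => h h'.symm)]
    rw [hmon]
    by_cases h : ∑ j : Fin n, t.2 j * w j = D
    · rw [if_pos h, decide_eq_true h]
      simp
    · rw [if_neg h, decide_eq_false h]
      simp

/-- **The `hcert` entry of a chart stratum from list data and a cell certificate** (`c = 2`).  Data: unimodular `V`, stratum `S`,
defining equations `F_l`, strict transforms `g_l` with exponent shifts `d_l` (witnessed termwise: `V·m = d_l + m'`), and the cell's
initial forms `G_l`; checks: the `θ`-factorisation witness (a), the congruence `G_l ≡ in_{w_S} F_l` (b); input (c): the cell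
certificate for `G`.  Output: the smooth-face certificate entry for `(g(Y_S = 0), S)` VERBATIM as consumed by
`CIConeFiModelSmooth.ciConeFiModelRel_of_smoothFaceCertificates`. [folklore] -/
theorem hcert_entry_of_lists (p : ℕ) [CharP K p] (V : Matrix (Fin n) (Fin n) ℕ) (hV : IsUnit (V.map (Nat.cast : ℕ → ℤ)).det)
    (S : Finset (Fin n)) (FL gL G : Fin 2 → List (ℤ × (Fin n → ℕ))) (d : Fin 2 → Fin n → ℕ)
    (hθ : ∀ l, List.Forall₂ (fun t t' : ℤ × (Fin n → ℕ) => t.1 = t'.1 ∧ V.mulVec t.2 = d l + t'.2) (FL l) (gL l))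
    (hG : ∀ l, ∀ v ∈ (G l).map (fun t : ℤ × (Fin n → ℕ) => t.2) ++
        ((FL l).filter fun t : ℤ × (Fin n → ℕ) => ∑ j : Fin n, t.2 j * (∑ i ∈ S, V i j) = ∑ i ∈ S, d l i).map
          (fun t : ℤ × (Fin n → ℕ) => t.2),
      (p : ℤ) ∣ (((G l).filter fun t : ℤ × (Fin n → ℕ) => t.2 = v).map (fun t : ℤ × (Fin n → ℕ) => t.1)).sum -
        ((((FL l).filter fun t : ℤ × (Fin n → ℕ) => ∑ j : Fin n, t.2 j * (∑ i ∈ S, V i j) = ∑ i ∈ S, d l i).filter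
          fun t : ℤ × (Fin n → ℕ) => t.2 = v).map (fun t : ℤ × (Fin n → ℕ) => t.1)).sum)
    (e : Fin n → ℕ) {t : ℕ} (cols : Fin t → Fin 2 → Fin n)
    (hcell : (monomial (Finsupp.equivFunOnFinite.symm e) (1 : K) : MvPolynomial (Fin n) K) ∈
      Ideal.span (Set.range fun l : Fin 2 =>
          ((G l).map fun t : ℤ × (Fin n → ℕ) =>
            (monomial (Finsupp.equivFunOnFinite.symm t.2) ((t.1 : ℤ) : K) : MvPolynomial (Fin n) K)).sum) ⊔
        Ideal.span (Set.range fun μ : Fin t => (Matrix.of fun a l => pderiv (cols μ a)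
          (((G l).map fun t : ℤ × (Fin n → ℕ) =>
            (monomial (Finsupp.equivFunOnFinite.symm t.2) ((t.1 : ℤ) : K) : MvPolynomial (Fin n) K)).sum)).det)) :
    ∃ (tt : ℕ) (js : Fin tt → Fin 2 → Fin n) (e' : Fin n →₀ ℕ), (∀ i ∈ S, e' i = 0) ∧
      (monomial e' (1 : K) : MvPolynomial (Fin n) K) ∈
        Ideal.span (Set.range fun l : Fin 2 =>
            aeval (fun i : Fin n => if i ∈ S then (0 : MvPolynomial (Fin n) K) else X i)
              ((gL l).map fun t : ℤ × (Fin n → ℕ) =>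
                (monomial (Finsupp.equivFunOnFinite.symm t.2) ((t.1 : ℤ) : K) : MvPolynomial (Fin n) K)).sum) ⊔
          Ideal.span (Set.range fun ν : Fin tt => (Matrix.of fun a l => pderiv (js ν a)
            (aeval (fun i : Fin n => if i ∈ S then (0 : MvPolynomial (Fin n) K) else X i)
              ((gL l).map fun t : ℤ × (Fin n → ℕ) =>
                (monomial (Finsupp.equivFunOnFinite.symm t.2) ((t.1 : ℤ) : K) : MvPolynomial (Fin n) K)).sum)).det) := by
  have hθF : ∀ l, aeval (fun j : Fin n => ∏ i : Fin n, (X i : MvPolynomial (Fin n) K) ^ V i j)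
      ((FL l).map fun t : ℤ × (Fin n → ℕ) =>
        (monomial (Finsupp.equivFunOnFinite.symm t.2) ((t.1 : ℤ) : K) : MvPolynomial (Fin n) K)).sum =
      monomial (Finsupp.equivFunOnFinite.symm (d l)) 1 *
        ((gL l).map fun t : ℤ × (Fin n → ℕ) =>
          (monomial (Finsupp.equivFunOnFinite.symm t.2) ((t.1 : ℤ) : K) : MvPolynomial (Fin n) K)).sum :=
    fun l => CIPolyKit.theta_evalL V (d l) (FL l) (gL l) (hθ l)
  have hP : ∀ l, monomial (Finsupp.equivFunOnFinite.symm (d l)) (1 : K) *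
      aeval (fun i : Fin n => if i ∈ S then (0 : MvPolynomial (Fin n) K) else X i)
        ((gL l).map fun t : ℤ × (Fin n → ℕ) =>
          (monomial (Finsupp.equivFunOnFinite.symm t.2) ((t.1 : ℤ) : K) : MvPolynomial (Fin n) K)).sum =
      aeval (fun j : Fin n => ∏ i : Fin n, (X i : MvPolynomial (Fin n) K) ^ V i j)
        ((G l).map fun t : ℤ × (Fin n → ℕ) =>
          (monomial (Finsupp.equivFunOnFinite.symm t.2) ((t.1 : ℤ) : K) : MvPolynomial (Fin n) K)).sum := by
    intro l
    rw [ToricChartFedder.monomial_mul_substZero_eq_theta_component V hV _ _ _ (hθF l) S, weightedHomogeneousComponent_evalL]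
    simp only [Finsupp.coe_equivFunOnFinite_symm]
    rw [CIPolyKit.evalL_eq_of_coeff_congr p (G l) _ (hG l)]
  exact hcert_of_cellCertificate V hV S _ _ (fun l => Finsupp.equivFunOnFinite.symm (d l)) hP
    (Finsupp.equivFunOnFinite.symm e) cols hcell

end Summit.ResolutionOfSingularities.ResolutionOfSingularities.Theorems.FInjectiveMacaulayfication.CIThetaTransport

end
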